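import Summits.RiemannHypothesis.RiemannHypothesis.Theorems.Splittings.RobinFiniteLowHeightInputs
import HarnessLib


/-!
# RobinFiniteLowHeightCells — gen 11 low-height CA law, part 2/4 (B): the budget-parametric cell certificate

The landed covers `cover11 … cover17` (`RobinAnalyticSharp`) RE-CERTIFIED by `decide +kernel` against the β-FREE box of
`RobinFiniteE3Error.Eb_mul_le_box` at a budget PARAMETER `b : ℚ` (`coverOKB b k …`; the landed `Cell.checkRH` fixes
`bU = 0.0552`): certified level budgets `b₁₁ … b₁₇ = 0.105, 0.22, 0.30, 0.37, 0.42, 0.47, 0.50` (`bk`), soundness =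
`RobinFiniteE3Cells.cell_soundW / cell_soundFirstW / tail_soundW / cover_keyW` verbatim with the box discharged on the level
`[4ᵏ, 4ᵏ⁺¹]`, and the key inequality `Eb b' P < G₁ + G₂` for every `b' ≤ b_k` (`key_ineq_levelB`).  6 `def` (checkers + table;
definition lane), 7 kernel certificates (standard axioms only — `decide +kernel`, no `native_decide`).

HONEST LABEL: SPLITTING SEARCH over kernel-typed RH-EQUIVALENCES; a splitting A ∧ B ⟹ RH is CONDITIONAL
bookkeeping unless A and B are both proved; nothing here bears on the truth of RH.
-/

set_option linter.dupNamespace false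

noncomputable section

open Real Filter Finset
open scoped Chebyshev

namespace Summit.RiemannHypothesis.RiemannHypothesis.Theorems.Splittings.RobinFiniteC1

open Literature.NumberTheory.LFunctions Literature.NumberTheory.DiophantineGeometry
open RobinAnalyticSharp RobinAnalyticSharp.Cells
open Summit.RiemannHypothesis.RiemannHypothesis.Theorems.Splittings.RobinFiniteE3

section LowHeight

/-! ### B · the budget-parametric cell certificate

The landed covers `cover11 … cover17` (`RobinAnalyticSharp.lean`) are re-checked against the β-FREE box of
`RobinFiniteE3Error.Eb_mul_le_box` — `(b + 2.042) − (2.042 − b)/L₂ + (8.168 + 4b)/L₁² + 1.84/s₁ + 2·p16 + U₁⁴/(631.65·s₁)` —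
at a budget PARAMETER `b : ℚ` (the landed `Cell.checkRH` fixes `bU = 0.0552`).  Soundness proofs = the landed
`RobinFiniteE3Cells.cell_soundW / cell_soundFirstW / tail_soundW / cover_keyW` verbatim with the box hypothesis discharged by
`Eb_mul_le_box` on the level `[4ᵏ, 4ᵏ⁺¹]`. -/

/-- Rational twin of the β-free box of `Eb_mul_le_box` on the level `[4ᵏ, 4ᵏ⁺¹]` (`y₁ = 1/p16`). -/
def eBoxEbQ (b : ℚ) (k : ℕ) (p16 : ℚ) : ℚ :=
  (b + 2.042) - (2.042 - b) / L2 k + (8.168 + 4 * b) / L1 k ^ 2 + 1.84 / s1 k + 2 * p16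
    + U1 k ^ 4 / (631.65 * s1 k)

/-- Cell check at budget `b`: the landed structural check and the β-free box inequality. -/
def cellCheckB (b : ℚ) (c : Cell) : Bool :=
  c.check && decide (eBoxEbQ b c.k c.p16 < c.g1BoxQ + c.g2BoxQ)

/-- First-cell check at budget `b` (must pass with `G₂` alone). -/
def cellCheckFirstB (b : ℚ) (c : Cell) : Bool :=
  c.checkFirst && decide (eBoxEbQ b c.k c.p16 < c.g2BoxQ)

/-- Tail check at budget `b`. -/
def checkTailB (b : ℚ) (k : ℕ) (A : Anchor) (p16 : ℚ) : Bool :=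
  checkTail k A p16 && decide (eBoxEbQ b k p16 < (1 - A.deltaU) * (A.n / 2 ^ k) /
        ((2 + dP k + A.deltaU) * (1 + ((2 + dP k + A.deltaU) - 1) / L1 k)))

/-- The full check of a `P`-level at budget `b` (shape of `coverOKRH`). -/
def coverOKB (b : ℚ) (k : ℕ) (l : List Cell) (T : Anchor) (p16 : ℚ) : Bool :=
  match l with
  | [] => false
  | c₀ :: _ => cellCheckFirstB b c₀ && decide (599 ≤ c₀.A₂.n) && decide (599 ≤ T.n)
      && l.all (fun c => cellCheckB b c && (c.k == k)) && chainOK l && (lastN l == T.n)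
      && checkTailB b k T p16

/-- The cast of the rational box. -/
theorem eBoxEbQ_cast (b : ℚ) (k : ℕ) (p16 : ℚ) :
    ((eBoxEbQ b k p16 : ℚ) : ℝ) = ((b : ℝ) + 2.042) - (2.042 - (b : ℝ)) / (L2 k : ℝ) + (8.168 + 4 * (b : ℝ)) / (L1 k : ℝ) ^ 2
      + 1.84 / (s1 k : ℝ) + 2 * (p16 : ℝ) + (U1 k : ℝ) ^ 4 / (631.65 * (s1 k : ℝ)) := by
  simp only [eBoxEbQ]; push_cast; ring

/-- **`Eb b` lies under the rational box on the level `[4ᵏ, 4ᵏ⁺¹]`** (`Eb_mul_le_box` with the enclosures `range_facts` and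
`y₁ = 1/p16 ≤ (4ᵏ)^{1/6}` from `1 ≤ p16⁶·4ᵏ`), for `0 ≤ b ≤ 2.042`. -/
theorem Eb_mul_le_levelBox {b p16 : ℚ} {k : ℕ} (hk : 6 ≤ k) (hb0 : (0 : ℝ) ≤ b) (hb2 : (b : ℝ) ≤ 2.042)
    (hp0 : 0 < p16) (hp6 : 1 ≤ p16 ^ 6 * 4 ^ k) {P : ℝ} (hPl : (4 : ℝ) ^ k ≤ P) (hPu : P ≤ (4 : ℝ) ^ (k + 1)) :
    (nicolasERH P + ((b : ℝ) - nicolasBeta) * (1 / (√P * Real.log P) + 1 / (√P * Real.log P ^ 2) + 4 / (√P * Real.log P ^ 3))) * (√P * Real.log P) ≤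
      ((eBoxEbQ b k p16 : ℚ) : ℝ) := by
  obtain ⟨hP₁599, hL₁, hU₁, hL₂, hL₁8, hs₁, hs₁0⟩ := range_facts hk
  have hp0r : (0 : ℝ) < (p16 : ℝ) := by exact_mod_cast hp0
  have hp6r : (1 : ℝ) ≤ (p16 : ℝ) ^ 6 * (4 : ℝ) ^ k := by exact_mod_cast hp6
  have hy₁0 : (0 : ℝ) < 1 / (p16 : ℝ) := by positivity
  have hy₁ : 1 / (p16 : ℝ) ≤ ((4 : ℝ) ^ k) ^ ((1 : ℝ) / 6) := by
    refine le_rpow_sixth (by positivity) ?_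
    rw [one_div, inv_pow, inv_le_iff_one_le_mul₀ (by positivity)]
    linarith
  have h := Eb_mul_le_box hb0 hb2 (lt_of_lt_of_le (by norm_num) hP₁599) hPl hPu hL₁ hU₁ hL₂ hL₁8 hs₁ hs₁0 hy₁ hy₁0
  rw [eBoxEbQ_cast]
  have e : (2 : ℝ) / (1 / (p16 : ℝ)) = 2 * (p16 : ℝ) := by field_simp
  linarith [e]

/-- `cell_soundW` at budget `b` for `Ef = Eb b` (proof verbatim; ends in `cell_keyW`). -/
theorem cell_soundB {B : ℝ} (hW : (∀ y : ℝ, 599 ≤ y → y ≤ B → |θ y - y| ≤ √y * Real.log y ^ 2 / (8 * π)))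
    {b : ℚ} (hb0 : (0 : ℝ) ≤ b) (hb2 : (b : ℝ) ≤ 2.042)
    (c : Cell) (hc : cellCheckB b c = true) {P Q : ℕ} (hPl : 4 ^ c.k ≤ P) (hPu : P ≤ 4 ^ (c.k + 1))
    (hPB : (P : ℝ) ≤ B) (hQ : 599 ≤ Q) (hQP : Q ≤ P)
    (hQ₁ : (c.A₁.n : ℝ) * √(P : ℝ) ≤ (Q : ℝ) * 2 ^ c.k)
    (hQ₂ : (Q : ℝ) * 2 ^ c.k ≤ (c.A₂.n : ℝ) * √(P : ℝ)) :
    (nicolasERH P + ((b : ℝ) - nicolasBeta) * (1 / (√P * Real.log P) + 1 / (√P * Real.log P ^ 2) + 4 / (√P * Real.log P ^ 3))) <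
      ∑ p ∈ (Nat.primesLE P).filter (fun p => Q < p), ((p : ℝ) ^ 2)⁻¹ +
        θ Q / ((θ P + θ Q) * Real.log (θ P + θ Q)) := by
  simp only [cellCheckB, Bool.and_eq_true, decide_eq_true_eq] at hc
  obtain ⟨hc, hcellB⟩ := hc
  simp only [Cell.check, Bool.and_eq_true, Bool.or_eq_true, decide_eq_true_eq] at hc
  obtain ⟨⟨⟨⟨⟨⟨⟨⟨⟨⟨hA₁, hA₂⟩, hn⟩, hk⟩, hp0⟩, hp6⟩, hd1⟩, hell0⟩, hκ⟩, hla⟩, -⟩ := hc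
  obtain ⟨hP₁599, hL₁, hU₁, hL₂, hL₁8, hs₁, hs₁0⟩ := range_facts hk
  have hPl' : (4 : ℝ) ^ c.k ≤ P := by exact_mod_cast hPl
  have hPu' : (P : ℝ) ≤ (4 : ℝ) ^ (c.k + 1) := by exact_mod_cast hPu
  have h2k : (0 : ℝ) < 2 ^ c.k := by positivity
  have hP0 : (0 : ℝ) < P := lt_of_lt_of_le (by positivity) hPl'
  -- `a₁`, `a₂`
  have ha₁ : ((c.a1 : ℚ) : ℝ) * √(P : ℝ) ≤ Q := by
    simp only [Cell.a1]; push_cast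
    rw [div_mul_eq_mul_div, div_le_iff₀ h2k]; exact hQ₁
  have ha₂ : (Q : ℝ) ≤ ((c.a2 : ℚ) : ℝ) * √(P : ℝ) := by
    simp only [Cell.a2]; push_cast
    rw [div_mul_eq_mul_div, le_div_iff₀ h2k]; exact hQ₂
  have ha₁0 : (0 : ℝ) ≤ ((c.a1 : ℚ) : ℝ) := by simp only [Cell.a1]; push_cast; positivity
  have hn₂ : (1 : ℝ) ≤ c.A₂.n := by exact_mod_cast (Nat.succ_le_of_lt (lt_of_le_of_lt (Nat.zero_le _) hn))
  have ha₂0 : (0 : ℝ) < ((c.a2 : ℚ) : ℝ) := by simp only [Cell.a2]; push_cast; positivity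
  -- the anchor `a₁ √P₁ = n₁`
  have e₁ : ((c.a1 : ℚ) : ℝ) * √((4 : ℝ) ^ c.k) = c.A₁.n := by
    rw [sqrt_four_pow]; simp only [Cell.a1]; push_cast; field_simp
  have hd₁ : schoenfeldDelta (max 599 (((c.a1 : ℚ) : ℝ) * √((4 : ℝ) ^ c.k))) ≤ ((c.d1 : ℚ) : ℝ) := by
    rw [e₁]
    by_cases h : 599 ≤ c.A₁.n
    · have hv : c.A₁.valid = true := hA₁.resolve_left (not_lt.2 h)
      rw [max_eq_right (by exact_mod_cast h)]
      simp only [Cell.d1, if_pos h]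
      exact c.A₁.delta_le hv
    · push Not at h
      rw [max_eq_left (by exact_mod_cast h.le)]
      simp only [Cell.d1, if_neg (not_le.2 h), d599]
      have := schoenfeldDelta_599_le
      push_cast; linarith
  have hd₁1 : ((c.d1 : ℚ) : ℝ) ≤ 1 / 2 := by
    have h := (Rat.cast_le (K := ℝ)).2 hd1; push_cast at h; exact h
  have hdP : schoenfeldDelta ((4 : ℝ) ^ c.k) ≤ ((dP c.k : ℚ) : ℝ) := dP_sound c.k
  have hℓ₁ : ((c.ell1 : ℚ) : ℝ) ≤ Real.log (max 599 (((c.a1 : ℚ) : ℝ) * √((4 : ℝ) ^ c.k))) := by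
    rw [e₁]
    by_cases h : 599 ≤ c.A₁.n
    · have hv : c.A₁.valid = true := hA₁.resolve_left (not_lt.2 h)
      rw [max_eq_right (by exact_mod_cast h)]
      simp only [Cell.ell1, if_pos h]
      exact (c.A₁.log_bounds hv).1
    · push Not at h
      rw [max_eq_left (by exact_mod_cast h.le)]
      simp only [Cell.ell1, if_neg (not_le.2 h)]
      exact ell599_le
  have hℓ₁0 : (0 : ℝ) < ((c.ell1 : ℚ) : ℝ) := by exact_mod_cast hell0
  have hL₁0 : (0 : ℝ) < ((L1 c.k : ℚ) : ℝ) := by linarith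
  -- `mlow`
  obtain ⟨hm0, hm⟩ := c.mlow_facts hA₂ hla hL₁0 ha₂0
  have hcR : (1 + ((dP c.k : ℚ) : ℝ)) + (1 + ((c.d1 : ℚ) : ℝ)) * ((c.a2 : ℚ) : ℝ) / ((s1 c.k : ℚ) : ℝ) ≤
      ((c.cR : ℚ) : ℝ) := by
    simp only [Cell.cR]; push_cast; exact le_rfl
  have hκ' : (0 : ℝ) ≤ (1 - ((c.d1 : ℚ) : ℝ)) * (((c.ell1 : ℚ) : ℝ) / (((c.ell1 : ℚ) : ℝ) + 1)) -
      2 * ((c.d1 : ℚ) : ℝ) := by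
    have : (0 : ℝ) ≤ ((c.kappa : ℚ) : ℝ) := by exact_mod_cast hκ
    simp only [Cell.kappa] at this; push_cast at this; exact this
  have hcell' : ((eBoxEbQ b c.k c.p16 : ℚ) : ℝ) <
      g1Box (c.d1 : ℝ) (c.a1 : ℝ) (c.cR : ℝ) (L1 c.k : ℝ) + g2Box (c.d1 : ℝ) (c.ell1 : ℝ) (c.mlow : ℝ) (s1 c.k : ℝ) := by
    rw [← g1BoxQ_cast, ← g2BoxQ_cast]; exact_mod_cast hcellB
  have hE := Eb_mul_le_levelBox hk hb0 hb2 hp0 hp6 hPl' hPu'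
  exact cell_keyW hW hQ hQP hPB hP₁599 hPl' ha₁ ha₂ ha₁0 ha₂0 hd₁ hd₁1 hdP hℓ₁ hℓ₁0 hL₁ hL₁0 hs₁ hs₁0
    hm0 hm hcR hκ' (hE.trans_lt hcell')

/-- `cell_soundFirstW` at budget `b` (ends in `small_Q_keyW`). -/
theorem cell_soundFirstB {B : ℝ} (hW : (∀ y : ℝ, 599 ≤ y → y ≤ B → |θ y - y| ≤ √y * Real.log y ^ 2 / (8 * π)))
    {b : ℚ} (hb0 : (0 : ℝ) ≤ b) (hb2 : (b : ℝ) ≤ 2.042)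
    (c : Cell) (hc : cellCheckFirstB b c = true) (hn₂ : 599 ≤ c.A₂.n) {P Q : ℕ} (hPl : 4 ^ c.k ≤ P)
    (hPu : P ≤ 4 ^ (c.k + 1)) (hPB : (P : ℝ) ≤ B) (hQ : Q ≤ 599) :
    (nicolasERH P + ((b : ℝ) - nicolasBeta) * (1 / (√P * Real.log P) + 1 / (√P * Real.log P ^ 2) + 4 / (√P * Real.log P ^ 3))) <
      ∑ p ∈ (Nat.primesLE P).filter (fun p => Q < p), ((p : ℝ) ^ 2)⁻¹ +
        θ Q / ((θ P + θ Q) * Real.log (θ P + θ Q)) := by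
  simp only [cellCheckFirstB, Bool.and_eq_true, decide_eq_true_eq] at hc
  obtain ⟨hc, hcellB⟩ := hc
  simp only [Cell.checkFirst, Cell.check, Bool.and_eq_true, Bool.or_eq_true, decide_eq_true_eq,
    beq_iff_eq] at hc
  obtain ⟨⟨⟨⟨⟨⟨⟨⟨⟨⟨⟨⟨hA₁, hA₂⟩, hn⟩, hk⟩, hp0⟩, hp6⟩, hd1⟩, hell0⟩, hκ⟩, hla⟩, -⟩, hzero⟩, -⟩ := hc
  obtain ⟨hP₁599, hL₁, hU₁, hL₂, hL₁8, hs₁, hs₁0⟩ := range_facts hk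
  have hPl' : (4 : ℝ) ^ c.k ≤ P := by exact_mod_cast hPl
  have hPu' : (P : ℝ) ≤ (4 : ℝ) ^ (c.k + 1) := by exact_mod_cast hPu
  have h2k : (0 : ℝ) < 2 ^ c.k := by positivity
  have h599P : 599 ≤ P := by
    have : (599 : ℝ) ≤ P := hP₁599.trans hPl'
    exact_mod_cast this
  have hn₂r : (599 : ℝ) ≤ c.A₂.n := by exact_mod_cast hn₂
  have ha₂0 : (0 : ℝ) < ((c.a2 : ℚ) : ℝ) := by simp only [Cell.a2]; push_cast; positivity
  have ha₂ : (599 : ℝ) ≤ ((c.a2 : ℚ) : ℝ) * √(P : ℝ) := by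
    simp only [Cell.a2]; push_cast
    have hsP : (2 : ℝ) ^ c.k ≤ √(P : ℝ) := by rw [← sqrt_four_pow]; exact Real.sqrt_le_sqrt hPl'
    rw [div_mul_eq_mul_div, le_div_iff₀ h2k]
    calc (599 : ℝ) * 2 ^ c.k ≤ c.A₂.n * 2 ^ c.k := by gcongr
      _ ≤ c.A₂.n * √(P : ℝ) := by gcongr
  have hlt : c.A₁.n < 599 := by rw [hzero]; norm_num
  have hd₁ : schoenfeldDelta 599 ≤ ((c.d1 : ℚ) : ℝ) := by
    simp only [Cell.d1, if_neg (not_le.2 hlt), d599]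
    have := schoenfeldDelta_599_le; push_cast; linarith
  have hd₁1 : ((c.d1 : ℚ) : ℝ) ≤ 1 / 2 := by
    have h := (Rat.cast_le (K := ℝ)).2 hd1; push_cast at h; exact h
  have hℓ₁ : ((c.ell1 : ℚ) : ℝ) ≤ Real.log 599 := by
    simp only [Cell.ell1, if_neg (not_le.2 hlt)]; exact ell599_le
  have hℓ₁0 : (0 : ℝ) < ((c.ell1 : ℚ) : ℝ) := by exact_mod_cast hell0
  have hL₁0 : (0 : ℝ) < ((L1 c.k : ℚ) : ℝ) := by linarith
  obtain ⟨hm0, hm⟩ := c.mlow_facts hA₂ hla hL₁0 ha₂0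
  have hκ' : (0 : ℝ) ≤ (1 - ((c.d1 : ℚ) : ℝ)) * (((c.ell1 : ℚ) : ℝ) / (((c.ell1 : ℚ) : ℝ) + 1)) -
      2 * ((c.d1 : ℚ) : ℝ) := by
    have : (0 : ℝ) ≤ ((c.kappa : ℚ) : ℝ) := by exact_mod_cast hκ
    simp only [Cell.kappa] at this; push_cast at this; exact this
  have hcell' : ((eBoxEbQ b c.k c.p16 : ℚ) : ℝ) < g2Box (c.d1 : ℝ) (c.ell1 : ℝ) (c.mlow : ℝ) (s1 c.k : ℝ) := by
    rw [← g2BoxQ_cast]; exact_mod_cast hcellB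
  have hE := Eb_mul_le_levelBox hk hb0 hb2 hp0 hp6 hPl' hPu'
  exact small_Q_keyW hW hQ h599P hPB hP₁599 hPl' ha₂ ha₂0 hd₁ hd₁1 hℓ₁ hℓ₁0 hL₁ hs₁ hs₁0 hm0 hm hκ'
    (hE.trans_lt hcell')

/-- `tail_soundW` at budget `b` (ends in `large_Q_keyW`). -/
theorem tail_soundB {B : ℝ} (hW : (∀ y : ℝ, 599 ≤ y → y ≤ B → |θ y - y| ≤ √y * Real.log y ^ 2 / (8 * π)))
    {b : ℚ} (hb0 : (0 : ℝ) ≤ b) (hb2 : (b : ℝ) ≤ 2.042)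
    (k : ℕ) (A : Anchor) (p16 : ℚ) (h : checkTailB b k A p16 = true) (hn : 599 ≤ A.n) {P Q : ℕ} (hPl : 4 ^ k ≤ P)
    (hPu : P ≤ 4 ^ (k + 1)) (hPB : (P : ℝ) ≤ B) (hQ : 599 ≤ Q) (hQP : Q ≤ P)
    (hQ₁ : (A.n : ℝ) * √(P : ℝ) ≤ (Q : ℝ) * 2 ^ k) :
    (nicolasERH P + ((b : ℝ) - nicolasBeta) * (1 / (√P * Real.log P) + 1 / (√P * Real.log P ^ 2) + 4 / (√P * Real.log P ^ 3))) <
      ∑ p ∈ (Nat.primesLE P).filter (fun p => Q < p), ((p : ℝ) ^ 2)⁻¹ +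
        θ Q / ((θ P + θ Q) * Real.log (θ P + θ Q)) := by
  simp only [checkTailB, Bool.and_eq_true, decide_eq_true_eq] at h
  obtain ⟨h, hcellB⟩ := h
  simp only [checkTail, Bool.and_eq_true, decide_eq_true_eq] at h
  obtain ⟨⟨⟨⟨⟨hA, hk⟩, hp0⟩, hp6⟩, hd1⟩, -⟩ := h
  obtain ⟨hP₁599, hL₁, hU₁, hL₂, hL₁8, hs₁, hs₁0⟩ := range_facts hk
  have hPl' : (4 : ℝ) ^ k ≤ P := by exact_mod_cast hPl
  have hPu' : (P : ℝ) ≤ (4 : ℝ) ^ (k + 1) := by exact_mod_cast hPu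
  have h2k : (0 : ℝ) < 2 ^ k := by positivity
  set a : ℝ := (A.n : ℝ) / 2 ^ k with ha_def
  have ha : a * √(P : ℝ) ≤ Q := by
    rw [ha_def, div_mul_eq_mul_div, div_le_iff₀ h2k]; exact hQ₁
  have ha0 : 0 ≤ a := by rw [ha_def]; positivity
  have e₁ : a * √((4 : ℝ) ^ k) = A.n := by rw [sqrt_four_pow, ha_def]; field_simp
  have hnr : (599 : ℝ) ≤ A.n := by exact_mod_cast hn
  have hd₁ : schoenfeldDelta (max 599 (a * √((4 : ℝ) ^ k))) ≤ ((A.deltaU : ℚ) : ℝ) := by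
    rw [e₁, max_eq_right hnr]; exact A.delta_le hA
  have hd₁1 : ((A.deltaU : ℚ) : ℝ) ≤ 1 / 2 := by
    have h := (Rat.cast_le (K := ℝ)).2 hd1; push_cast at h; exact h
  have hdP : schoenfeldDelta ((4 : ℝ) ^ k) ≤ ((dP k : ℚ) : ℝ) := dP_sound k
  have hc : 2 + ((dP k : ℚ) : ℝ) + ((A.deltaU : ℚ) : ℝ) ≤ 2 + ((dP k : ℚ) : ℝ) + ((A.deltaU : ℚ) : ℝ) :=
    le_rfl
  have hcell' : ((eBoxEbQ b k p16 : ℚ) : ℝ) <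
      (1 - ((A.deltaU : ℚ) : ℝ)) * a / ((2 + ((dP k : ℚ) : ℝ) + ((A.deltaU : ℚ) : ℝ)) *
        (1 + ((2 + ((dP k : ℚ) : ℝ) + ((A.deltaU : ℚ) : ℝ)) - 1) / ((L1 k : ℚ) : ℝ))) := by
    rw [ha_def]
    have h := (Rat.cast_lt (K := ℝ)).2 hcellB
    push_cast at h
    exact h
  have hE := Eb_mul_le_levelBox hk hb0 hb2 hp0 hp6 hPl' hPu'
  have hL₁0 : (0 : ℝ) < ((L1 k : ℚ) : ℝ) := by linarith
  exact large_Q_keyW hW hQ hQP hPB hP₁599 hPl' ha ha0 hd₁ hd₁1 hdP hL₁ hL₁0 hc (hE.trans_lt hcell')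

/-- `cover_keyW` at budget `b`: **`Eb b P < G₂ + G₁` on a certified level** `coverOKB b k l T p16 = true`. -/
theorem cover_keyB {B : ℝ} (hW : (∀ y : ℝ, 599 ≤ y → y ≤ B → |θ y - y| ≤ √y * Real.log y ^ 2 / (8 * π)))
    {b : ℚ} (hb0 : (0 : ℝ) ≤ b) (hb2 : (b : ℝ) ≤ 2.042) {k : ℕ} {l : List Cell}
    {T : Anchor} {p16 : ℚ} (h : coverOKB b k l T p16 = true) {P Q : ℕ} (hPl : 4 ^ k ≤ P)
    (hPu : P ≤ 4 ^ (k + 1)) (hPB : (P : ℝ) ≤ B) (hQP : Q ≤ P) :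
    (nicolasERH P + ((b : ℝ) - nicolasBeta) * (1 / (√P * Real.log P) + 1 / (√P * Real.log P ^ 2) + 4 / (√P * Real.log P ^ 3))) <
      ∑ p ∈ (Nat.primesLE P).filter (fun p => Q < p), ((p : ℝ) ^ 2)⁻¹ +
        θ Q / ((θ P + θ Q) * Real.log (θ P + θ Q)) := by
  match l, h with
  | c₀ :: t, h =>
    simp only [coverOKB, Bool.and_eq_true, decide_eq_true_eq, beq_iff_eq, List.all_eq_true] at h
    obtain ⟨⟨⟨⟨⟨⟨hfirst, h599⟩, hT599⟩, hall⟩, hchain⟩, hlast⟩, htail⟩ := h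
    have hk0 : c₀.k = k := (hall c₀ (by simp)).2
    have hPl' : (4 : ℝ) ^ k ≤ P := by exact_mod_cast hPl
    have hP0 : (0 : ℝ) < P := lt_of_lt_of_le (by positivity) hPl'
    have hsP : 0 < √(P : ℝ) := Real.sqrt_pos.2 hP0
    have h2k : (0 : ℝ) < 2 ^ k := by positivity
    rcases le_or_gt Q 599 with hQ | hQ
    · exact cell_soundFirstB hW hb0 hb2 c₀ hfirst h599 (hk0 ▸ hPl) (hk0 ▸ hPu) hPB hQ
    · have hQ' : 599 ≤ Q := hQ.le
      set x : ℝ := (Q : ℝ) * 2 ^ k / √(P : ℝ) with hx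
      rcases le_or_gt (T.n : ℝ) x with hT | hT
      · refine tail_soundB hW hb0 hb2 k T p16 htail hT599 hPl hPu hPB hQ' hQP ?_
        rwa [hx, le_div_iff₀ hsP] at hT
      · have hzero : c₀.A₁.n = 0 := by
          simp only [cellCheckFirstB, Cell.checkFirst, Bool.and_eq_true, beq_iff_eq,
            decide_eq_true_eq] at hfirst
          exact hfirst.1.1.2
        have hx0 : (c₀.A₁.n : ℝ) ≤ x := by rw [hzero, Nat.cast_zero]; positivity
        have hxl : x ≤ lastN (c₀ :: t) := by rw [hlast]; exact hT.le
        obtain ⟨c, hc, hc1, hc2⟩ := exists_bracket t c₀ hchain x hx0 hxl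
        obtain ⟨hcc, hck⟩ := hall c hc
        refine cell_soundB hW hb0 hb2 c hcc (hck ▸ hPl) (hck ▸ hPu) hPB hQ' hQP ?_ ?_
        · rw [hck]; rwa [hx, le_div_iff₀ hsP] at hc1
        · rw [hck]; rwa [hx, div_le_iff₀ hsP] at hc2

/-- The certified per-level budgets `b₁₁ … b₁₇` (exact rational margins of the landed covers against the β-free box:
`0.10564, 0.22409, 0.30524, 0.37266, 0.42751, 0.47260, 0.50955`). -/
def bk : ℕ → ℚ
  | 11 => 105 / 1000 | 12 => 22 / 100 | 13 => 30 / 100 | 14 => 37 / 100 | 15 => 42 / 100 | 16 => 47 / 100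
  | 17 => 50 / 100 | _ => 0

/-- Level 11 passes at budget `0.105` (kernel evaluation; cell data of `RobinAnalyticSharp.lean`). -/
theorem cover11B_ok : coverOKB (bk 11) 11 cover11 tail11 p16_11 = true := by decide +kernel
/-- Level 12 passes at budget `0.22`. -/
theorem cover12B_ok : coverOKB (bk 12) 12 cover12 tail12 p16_12 = true := by decide +kernel
/-- Level 13 passes at budget `0.30`. -/
theorem cover13B_ok : coverOKB (bk 13) 13 cover13 tail13 p16_13 = true := by decide +kernel
/-- Level 14 passes at budget `0.37`. -/
theorem cover14B_ok : coverOKB (bk 14) 14 cover14 tail14 p16_14 = true := by decide +kernel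
/-- Level 15 passes at budget `0.42`. -/
theorem cover15B_ok : coverOKB (bk 15) 15 cover15 tail15 p16_15 = true := by decide +kernel
/-- Level 16 passes at budget `0.47`. -/
theorem cover16B_ok : coverOKB (bk 16) 16 cover16 tail16 p16_16 = true := by decide +kernel
/-- Level 17 passes at budget `0.50`. -/
theorem cover17B_ok : coverOKB (bk 17) 17 cover17 tail17 p16_17 = true := by decide +kernel

/-- **Key inequality on a level `11 ≤ k ≤ 17` at any budget `b' ≤ b_k`**: `Eb b' P < G₂ + G₁` for `4ᵏ ≤ P ≤ 4ᵏ⁺¹ ≤ B`,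
`Q ≤ P` (the seven certificates dispatched on `k`, then `Eb_mono`). -/
theorem key_ineq_levelB {B : ℝ} (hW : (∀ y : ℝ, 599 ≤ y → y ≤ B → |θ y - y| ≤ √y * Real.log y ^ 2 / (8 * π)))
    {k : ℕ} (hk11 : 11 ≤ k) (hk17 : k ≤ 17) {P Q : ℕ} (hPl : 4 ^ k ≤ P) (hPu : P ≤ 4 ^ (k + 1))
    (hPB : (P : ℝ) ≤ B) (hQP : Q ≤ P) {b' : ℝ} (hb' : b' ≤ ((bk k : ℚ) : ℝ)) :
    (nicolasERH P + (b' - nicolasBeta) * (1 / (√P * Real.log P) + 1 / (√P * Real.log P ^ 2) + 4 / (√P * Real.log P ^ 3))) <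
      ∑ p ∈ (Nat.primesLE P).filter (fun p => Q < p), ((p : ℝ) ^ 2)⁻¹ +
        θ Q / ((θ P + θ Q) * Real.log (θ P + θ Q)) := by
  have hPr : (4 : ℝ) ^ k ≤ P := by exact_mod_cast hPl
  have hP1 : (1 : ℝ) < P := lt_of_lt_of_le (by norm_num) (le_trans (pow_le_pow_right₀ (by norm_num) hk11) hPr)
  refine lt_of_le_of_lt (Eb_mono hP1 hb') ?_
  interval_cases k
  · exact cover_keyB hW (by norm_num [bk]) (by norm_num [bk]) cover11B_ok hPl hPu hPB hQP
  · exact cover_keyB hW (by norm_num [bk]) (by norm_num [bk]) cover12B_ok hPl hPu hPB hQP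
  · exact cover_keyB hW (by norm_num [bk]) (by norm_num [bk]) cover13B_ok hPl hPu hPB hQP
  · exact cover_keyB hW (by norm_num [bk]) (by norm_num [bk]) cover14B_ok hPl hPu hPB hQP
  · exact cover_keyB hW (by norm_num [bk]) (by norm_num [bk]) cover15B_ok hPl hPu hPB hQP
  · exact cover_keyB hW (by norm_num [bk]) (by norm_num [bk]) cover16B_ok hPl hPu hPB hQP
  · exact cover_keyB hW (by norm_num [bk]) (by norm_num [bk]) cover17B_ok hPl hPu hPB hQP

end LowHeight

end Summit.RiemannHypothesis.RiemannHypothesis.Theorems.Splittings.RobinFiniteC1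

end
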